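import Summits.QuantumFields.YangMills.Theses.AntiScreeningCeilings

/-!
# Route `AntiScreeningCeilings` — LINE C glue: `SubhomogeneousSpectralMeasure → AbelWindowTransfer → ScaleMonotonicity`

D-0145 ideator seat ym-idea-11 (generation g4, lens «wuc»).  The spectral split of the crux `ScaleMonotonicity`
(stmt-QuantumFields-27233): child 1 gives, on every odd torus, a finite positive spectral measure `ν` on `(0,∞)`, `κ₀ ≥ 0` and a
shift `δ ≤ 1` representing the on-axis mirror covariance as `κ₀ + ∫ (e^{-E(t-δ)} + e^{-E(2L+1-δ-t)}) dν` for `2 ≤ t ≤ 2L-1`, with the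
degree-8 doubling bound of `ν([0,·))` above the onset energy `s/ℓ`; child 2 (pure analysis) turns doubling into quasi-monotonicity of
`t⁸ ·` (symmetrised Laplace transform) on windows `t₂ · E₀ ≤ 4`.  Here: the bookkeeping that the window of `ScaleMonotonicity`
(`4 ≤ t ≤ t₂ ≤ min(L, 2ℓ/s+2)`) forces `s ≤ ℓ`, hence `t₂ · (s/ℓ) ≤ 4`, and the shift/constant management.  Closes ONLY the glue item;
neither child, nor `ScaleMonotonicity`, nor any leaf / NT / UV / IR statement is proved.
-/

namespace Summit.QuantumFields.YangMills.Theses.AntiScreeningCeilings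

open MeasureTheory in
/-- LINE C glue (item `SpectralSplitGlue`): the spectral children imply `ScaleMonotonicity`.  Instantiate the Abel lemma at
`E₀ := s/ℓ`, `T := 2L+1-2δ`, shifted separations `t-δ ≤ t₂-δ`; constants `A·(1+e⁴)·(4/3)⁸`. -/
theorem spectralSplitGlue_proof : SpectralSplitGlue := by
  unfold SpectralSplitGlue
  intro hS hT G _ _ _ _ hG hiso r v f g h Λ₅
  obtain ⟨ε₀, hε₀, hmain⟩ := hS G hG hiso r v f g h Λ₅
  refine ⟨ε₀, hε₀, fun ε hε hεε hfl => ?_⟩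
  obtain ⟨ℓM, hℓM, hℓ⟩ := hmain ε hε hεε hfl
  refine ⟨ℓM, hℓM, fun ℓ hℓ0 hℓℓ => ?_⟩
  obtain ⟨A, βM, hA, hβ⟩ := hℓ ℓ hℓ0 hℓℓ
  refine ⟨A * (1 + Real.exp 4) * (4 / 3 : ℝ) ^ 8, βM, ?_, fun β hββ s hs0 hs1 hwin L q k t t₂ hq ht4 htt ht₂ℓ ht₂L => ?_⟩
  · have h1 : (1:ℝ) ≤ 1 + Real.exp 4 := by linarith [Real.exp_pos 4]
    have h2 : (1:ℝ) ≤ (4 / 3 : ℝ) ^ 8 := by norm_num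
    have h3 : (1:ℝ) ≤ A * (1 + Real.exp 4) := by nlinarith
    nlinarith
  obtain ⟨ν, κ₀, δ, hfin, hsupp, hκ₀, hδ, hrep, hsub⟩ := hβ β hββ s hs0 hs1 hwin L q k hq
  have hE₀ : 0 < s / ℓ := div_pos hs0 hℓ0
  have ht4R : (4:ℝ) ≤ (t : ℝ) := by exact_mod_cast ht4
  have httR : (t : ℝ) ≤ (t₂ : ℝ) := by exact_mod_cast htt
  have hδR : (δ : ℝ) ≤ 1 := by exact_mod_cast hδ
  have hδ0 : (0 : ℝ) ≤ (δ : ℝ) := Nat.cast_nonneg δ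
  have ht₂LR : (t₂ : ℝ) ≤ (L : ℝ) := by exact_mod_cast ht₂L
  have hsl : s ≤ ℓ := by
    have h2 : (2:ℝ) ≤ 2 * ℓ / s := by linarith
    rw [le_div_iff₀ hs0] at h2
    linarith
  have hwin4 : (t₂ : ℝ) * (s / ℓ) ≤ 4 := by
    rw [show (t₂ : ℝ) * (s / ℓ) = (t₂ : ℝ) * s / ℓ by ring, div_le_iff₀ hℓ0]
    have h3 : (t₂ : ℝ) * s ≤ (2 * ℓ / s + 2) * s := mul_le_mul_of_nonneg_right ht₂ℓ hs0.le
    have h4 : (2 * ℓ / s + 2) * s = 2 * ℓ + 2 * s := by field_simp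
    nlinarith
  have hwin4' : ((t₂ : ℝ) - δ) * (s / ℓ) ≤ 4 := by nlinarith [hE₀.le]
  have hT2 : 2 * ((t₂ : ℝ) - δ) ≤ (((2 * L + 1 : ℕ) : ℝ) - 2 * δ) := by push_cast; linarith
  have key := hT ν κ₀ A (s / ℓ) (((2 * L + 1 : ℕ) : ℝ) - 2 * δ) hfin hsupp hκ₀ hA hE₀ hsub ((t : ℝ) - δ) ((t₂ : ℝ) - δ)
    (by linarith) (by linarith) hT2 hwin4'
  rw [show (((2 * L + 1 : ℕ) : ℝ) - 2 * δ - ((t : ℝ) - δ)) = (((2 * L + 1 : ℕ) : ℝ) - δ - (t : ℝ)) by ring,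
    show (((2 * L + 1 : ℕ) : ℝ) - 2 * δ - ((t₂ : ℝ) - δ)) = (((2 * L + 1 : ℕ) : ℝ) - δ - (t₂ : ℝ)) by ring] at key
  have hrt := hrep t (by omega) (by omega)
  have hrt₂ := hrep t₂ (by omega) (by omega)
  have nonneg : ∀ τ : ℕ, 0 ≤ κ₀ + ∫ E, (Real.exp (-(E * ((τ : ℝ) - δ))) + Real.exp (-(E * (((2 * L + 1 : ℕ) : ℝ) - δ - (τ : ℝ))))) ∂ν :=
    fun τ => add_nonneg hκ₀ (integral_nonneg fun E => by positivity)
  rw [hrt, hrt₂, abs_of_nonneg (nonneg t), abs_of_nonneg (nonneg t₂)]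
  have hpow1 : (t : ℝ) ^ 8 ≤ (4 / 3 : ℝ) ^ 8 * ((t : ℝ) - δ) ^ 8 := by
    rw [← mul_pow]
    exact pow_le_pow_left₀ (by positivity) (by linarith) 8
  have hpow2 : ((t₂ : ℝ) - δ) ^ 8 ≤ (t₂ : ℝ) ^ 8 :=
    pow_le_pow_left₀ (by linarith) (by linarith) 8
  have hApos : 0 ≤ A * (1 + Real.exp 4) := by positivity
  calc (t : ℝ) ^ 8 * (κ₀ + ∫ E, (Real.exp (-(E * ((t : ℝ) - δ))) + Real.exp (-(E * (((2 * L + 1 : ℕ) : ℝ) - δ - (t : ℝ))))) ∂ν)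
      ≤ (4 / 3 : ℝ) ^ 8 * ((t : ℝ) - δ) ^ 8 * (κ₀ + ∫ E, (Real.exp (-(E * ((t : ℝ) - δ))) + Real.exp (-(E * (((2 * L + 1 : ℕ) : ℝ) - δ - (t : ℝ))))) ∂ν) :=
        mul_le_mul_of_nonneg_right hpow1 (nonneg t)
    _ = (4 / 3 : ℝ) ^ 8 * (((t : ℝ) - δ) ^ 8 * (κ₀ + ∫ E, (Real.exp (-(E * ((t : ℝ) - δ))) + Real.exp (-(E * (((2 * L + 1 : ℕ) : ℝ) - δ - (t : ℝ))))) ∂ν)) := by ring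
    _ ≤ (4 / 3 : ℝ) ^ 8 * (A * (1 + Real.exp 4) * ((t₂ : ℝ) - δ) ^ 8 * (κ₀ + ∫ E, (Real.exp (-(E * ((t₂ : ℝ) - δ))) + Real.exp (-(E * (((2 * L + 1 : ℕ) : ℝ) - δ - (t₂ : ℝ))))) ∂ν)) :=
        mul_le_mul_of_nonneg_left key (by positivity)
    _ ≤ (4 / 3 : ℝ) ^ 8 * (A * (1 + Real.exp 4) * (t₂ : ℝ) ^ 8 * (κ₀ + ∫ E, (Real.exp (-(E * ((t₂ : ℝ) - δ))) + Real.exp (-(E * (((2 * L + 1 : ℕ) : ℝ) - δ - (t₂ : ℝ))))) ∂ν)) := by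
        have := mul_le_mul_of_nonneg_right hpow2 (nonneg t₂)
        have := mul_le_mul_of_nonneg_left this hApos
        nlinarith
    _ = A * (1 + Real.exp 4) * (4 / 3 : ℝ) ^ 8 * (t₂ : ℝ) ^ 8 * (κ₀ + ∫ E, (Real.exp (-(E * ((t₂ : ℝ) - δ))) + Real.exp (-(E * (((2 * L + 1 : ℕ) : ℝ) - δ - (t₂ : ℝ))))) ∂ν) := by ring


end Summit.QuantumFields.YangMills.Theses.AntiScreeningCeilings
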